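import Summits.Langlands.Langlands.Theses.HodgeTatePurityCarving

/-!
# Route HodgeTatePurityCarving — Assembly

The assembly item (stmt-Langlands-26954) of the child route `HodgeTatePurityCarving` (decomp-langlands lens-6 gen 27; V-R refining child
`--refines route-Langlands-PrimeSwitchSplit:WeakGeometricAutomorphy`, 90th cell route, first thaw slot 2026-08-31) for
B_w = `PrimeSwitchSplit.WeakGeometricAutomorphy` (stmt-Langlands-17414):
`PureWeightAutomorphy → ImpureWeightAutomorphy → Summit.Langlands.Langlands.Theses.PrimeSwitchSplit.WeakGeometricAutomorphy`
(pointwise excluded middle on the ι-Hodge–Tate purity dial D(K,ℓ,ι,ρ)).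

This is literally the type of the route file's sorry-free deciding theorem `Summit.Langlands.Langlands.Theses.HodgeTatePurityCarving.closes`.
Nothing here proves `Langlands` (nor B_w): the assembly records only that the two cells of the route, taken together, imply the parent piece
by name.
-/

set_option linter.dupNamespace false -- project-wide option (lakefile weak.linter.dupNamespace); `Summit.Langlands.Langlands` is the mandated namespace

namespace Summit.Langlands.Langlands.Theorems

/-- **Assembly of route HodgeTatePurityCarving** (stmt-Langlands-26954):
`PureWeightAutomorphy → ImpureWeightAutomorphy → Summit.Langlands.Langlands.Theses.PrimeSwitchSplit.WeakGeometricAutomorphy`.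
Proof: unfold `Assembly` and apply the route's deciding theorem `Theses.HodgeTatePurityCarving.closes`. -/
theorem hodgeTatePurityCarving_assembly_proof :
    Summit.Langlands.Langlands.Theses.HodgeTatePurityCarving.Assembly := by
  unfold Summit.Langlands.Langlands.Theses.HodgeTatePurityCarving.Assembly
  exact Summit.Langlands.Langlands.Theses.HodgeTatePurityCarving.closes

end Summit.Langlands.Langlands.Theorems
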